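import Summits.ABC.ABC.Theses.TwistAmplification
import Summits.ABC.ABC.Theorems.SomeWindowSaving.Negative.WindowFinite
import Summits.ABC.ABC.Theorems.SomeWindowSaving.Negative.LoadBearing
import Summits.ABC.ABC.Theorems.SomeWindowSaving.Negative.LowerLaw
import Literature.Barriers.ABC.HallExponentSharp
import Literature.NumberTheory.DiophantineGeometry.AbcHallForms
import Literature.NumberTheory.DiophantineGeometry.MinimalDiscriminantNormProofs
import Literature.NumberTheory.EllipticCurves.SzpiroLocalDataProofs
import Literature.NumberTheory.EllipticCurves.SzpiroOfAbcProofs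
import Literature.NumberTheory.DiophantineGeometry.AbcImpliesHall

/-!
# Line `inert-box-collapse` for the crux `TwistAmplification.SomeWindowSaving` (stmt-ABC-1976)

Skeleton (crux-plan, round 1; re-certified and extended by the gen-2 seat, 2026-08-16).  The idea
card's lever, made exact: the window count of the crux is INERT — once the generalized Szpiro
quantity `M⁺ = max(|Δ_min|, |c₄|³)` is polynomially bounded in
the conductor (with SOME exponent), the window `(K+1, K+2]` contains only curves of bounded
conductor, hence is a fixed finite set and `δ = 0` is an admissible saving — and the polynomial
bound itself FACTORS through the discriminant:

* `stub_weakSzpiro` — conductor ↦ minimal discriminant: `|Δ_min| ≤ C · N^K` for SOME `K`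
  (Szpiro's conjecture in Oesterlé's weak form, Sém. Bourbaki 694 (1988) §2 Conj. 1, for all
  `E/ℚ`; open — best known `log|Δ_min| ≪ N log N`, Murty–Pasten 2013);
* `stub_weakHall` — discriminant ↦ `c₄`: Hall's bound `C · x^θ ≤ |x³ − y²|` with SOME `θ > 0`
  (the technique-class predicate `Literature.Barriers.ABC.HallBound θ C` of the barrier file
  `HallExponentSharp`; open for every `θ > 0`, Elkies 2000 §4.1), applied to
  `(x, y) = (c₄, c₆)`, `x³ − y² = 1728 Δ` (Mathlib `WeierstrassCurve.c_relation`).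

`SomeWindowSaving_of : stub_weakSzpiro-statement → stub_weakHall-statement → SomeWindowSaving` is
proved here without `sorry` (the two intermediate theorems `weakGenSzpiro_of_weakSzpiro_of_weakHall`
and `someWindowSaving_of_weakGenSzpiro` = the card's `InertBox`, over the landed
`Negative.WindowFinite.windowSet_finite`).  Both stubs are NECESSARY for the crux as well (modulo the
route's twist supports 1977/1978 and Shafarevich finiteness below `N₀`): crux ⟹ cofinite weak
generalized Szpiro (cdisprove calibration `someWindowSaving_iff_weakSzpiro`) ⟹ weak Szpiro, and ⟹
weak Hall via the Frey–Hall curves `Y² = X³ − 3xX − 2y` (`c₄ = 144x`, `Δ = 1728(x³ − y²)`); so the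
line loses no strength: `SomeWindowSaving ⟺ weak Szpiro ∧ weak Hall`.

Disproof used (cdisprove gen-1/gen-2, landed `Negative/*`, imported here so the scratch check sees them):
there is no `_false_without_` theorem for this crux (it RESISTS: ≡ weak generalized Szpiro); the load-bearing
lemmas `someWindowSaving_trivial_without_{lowerKappa,upperSigma,threshold}` (`Negative.LoadBearing`) are
honoured because `SomeWindowSaving_of` proves the crux BY NAME with all three side conditions (`3 < κ`,
`κ < σ`, `δ < (σ−κ)/(2σ−6)` — discharged in `someWindowSaving_of_weakGenSzpiro` as `3 < K+1`, `K+1 < K+2`,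
`0 < 1/(2K−2)`); the refuted strengthenings `not_windowSaving_below_third` / `not_windowSaving_below_law`
(`Negative.WindowSavingBelowThird`, `Negative.LowerLaw`: a witness window with `κ < 4` needs
`δ ≥ max(1/3, 1 − κ/6)`) are avoided because the witness window has `κ = K + 1 ≥ 4` (`K ≥ 3`).

Consistency relative to the summit (gen-2 addition, sorry-free, § at the end of the file): each stub is a
WEAKENING of a catalogued Literature conjecture typed in the same vocabulary (`weakSzpiro_of_szpiroConjecture`,
`weakHall_of_hallConjecture`), and the summit `_root_.ABC` implies both through PROVED theorems of the tree
(`szpiro_of_abcLe_holds`, `hallConjecture_of_abc`): `stubs_of_abc : ABC → WeakSzpiro ∧ WeakHall`, whence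
summit ⟹ stubs ⟹ crux (the last step as an unnamed `example`, so that `SomeWindowSaving_of` remains the ONLY
theorem of the file concluding the crux and the audit's choice of skeleton theorem is unambiguous).  So no
unconditional Negative lemma can refute a stub or the crux short of disproving abc, and the stub signatures are
pinned against the audited conjecture texts (a mis-typed norm, cast or exponent would break the two-line proofs).
-/

noncomputable section

namespace Summit.ABC.ABC.Cruxes.SomeWindowSaving.InertBoxCollapse

open IsDedekindDomain WeierstrassCurve
open Literature.Barriers.ABC (HallBound)
open Literature.NumberTheory.DiophantineGeometry (hallBound_int_of_hallBound)
open Summit.ABC.ABC.Theorems.SomeWindowSaving.Negative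

/-! ## The two stub STATEMENTS (named `Prop`s; the registered `stub_*` theorems below restate them
verbatim, `*_holds` certify the agreement definitionally, and `Registered.stub_*` are the name-keyed aliases
used as the hypotheses of `SomeWindowSaving_of` — the native skeleton audit admits a hypothesis by the last
name component of its head; same device as `Cruxes/SharpModerateLaw/Lines/deep-moduli-cusp-dispersion.lean`) -/

/-- Statement of STUB 1 — WEAK SZPIRO (`∃`-exponent form): there are `K, C` with
`|Δ_min(E)| ≤ C · N_E ^ K` for every elliptic curve `E/ℚ` (Oesterlé, Sém. Bourbaki 694 (1988), §2,
Conjecture 1 "Szpiro, forme faible" — there for semi-stable `E`; = Silverman AEC Conj. VIII.11.1 with `6 + ε`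
replaced by SOME `K`).  Same vocabulary as `Literature.NumberTheory.EllipticCurves.SzpiroConjecture`
(`minimalDiscriminantNorm ℤ`, `conductorNorm ℤ`, real exponent).  OPEN: the best unconditional bound is
`log |Δ_min| ≤ κ · N log N` (Murty–Pasten 2013; quoted as Thm 2.2 of Pasten, arXiv:2312.03566). -/
def WeakSzpiro : Prop :=
  ∃ K C : ℝ, ∀ (W : WeierstrassCurve ℚ) [W.IsElliptic],
    (W.minimalDiscriminantNorm ℤ : ℝ) ≤ C * (W.conductorNorm ℤ : ℝ) ^ K

/-- Statement of STUB 2 — WEAK HALL (`∃`-exponent form): Hall's bound `C · x ^ θ ≤ |x³ − y²|` over the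
positive naturals for SOME `θ > 0`, `C > 0` (`HallBound θ C` is the technique-class predicate of
`Literature/Barriers/ABC/HallExponentSharp.lean`; Hall 1971 asks `θ = 1/2`, the modern conjecture
`θ = 1/2 − ε`, abc.S17 `HallConjecture`).  OPEN for every `θ > 0` (Elkies 2000, §4.1: "it is not yet
possible to prove for any θ > 0 that |k| ≫ x^θ"; Baker-type bounds are powers of `log x`). -/
def WeakHall : Prop :=
  ∃ θ C : ℝ, 0 < θ ∧ 0 < C ∧ HallBound θ C

/-! ## The registered stubs (`sorry` lives only in these two theorems) -/

/-- **STUB 1 · `stub_weakSzpiro`** — weak Szpiro, `∃ K C, |Δ_min| ≤ C · N ^ K` for all `E/ℚ` (= `WeakSzpiro`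
verbatim).  OPEN classical problem (size XL): by the Frey curve it contains weak abc `c ≤ C' rad(abc)^{K/2}`;
engines on file output `exp`: Murty–Pasten `log|Δ| ≪ N log N` (modular degree / congruence number), Stewart–Yu
(Baker: `log c ≪ rad^{1/3+ε}`).  The polynomial-loss suppliers named on this crux (cards
polynomial-degree-suffices / hall-corner (M)): a polynomial modular-degree or Brandt-`ξ` bound with an inert
exponent (routes IsogenyGlueCongruence, DefiniteXi, RibetTakahashiSplit) gives this stub through Zagier's
degree formula WITHOUT the `c₄`-half. -/
theorem stub_weakSzpiro :
    ∃ K C : ℝ, ∀ (W : WeierstrassCurve ℚ) [W.IsElliptic],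
      (W.minimalDiscriminantNorm ℤ : ℝ) ≤ C * (W.conductorNorm ℤ : ℝ) ^ K := by
  sorry

/-- **STUB 2 · `stub_weakHall`** — weak Hall, `∃ θ > 0, ∃ C > 0, HallBound θ C`, i.e. `|x³ − y²| ≥ C x^θ`
for all positive naturals with `x³ ≠ y²` (= `WeakHall` verbatim).  OPEN classical problem (size XL): no
`θ > 0` is known (Elkies 2000 §4.1); it is the pure Diophantine-approximation face of the crux (how close can a
cube and a square be), conductor-free; consistent with the barrier `HallExponentSharp` (which only forbids
`θ > 1/2`, and `θ = 1/2` with `C ≥ 0.0215`). -/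
theorem stub_weakHall : ∃ θ C : ℝ, 0 < θ ∧ 0 < C ∧ HallBound θ C := by
  sorry

/-! ### Consistency: each named statement IS its registered stub (definitionally) -/

theorem weakSzpiro_holds : WeakSzpiro := stub_weakSzpiro
theorem weakHall_holds : WeakHall := stub_weakHall

/-! ### Name-keyed aliases of the two statements (the hypotheses of the composition) -/
namespace Registered

/-- Alias of `WeakSzpiro` keyed by the registered stub name. -/
abbrev stub_weakSzpiro : Prop := WeakSzpiro
/-- Alias of `WeakHall` keyed by the registered stub name. -/
abbrev stub_weakHall : Prop := WeakHall

end Registered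

/-! ## Proved glue -/

/-- From `c · t ^ θ ≤ s` (`t ≥ 0`, `c, θ > 0`): `t ^ 3 ≤ (s / c) ^ (3 / θ)`. -/
theorem pow_three_le_of_hall {t s c θ : ℝ} (ht : 0 ≤ t) (hc : 0 < c) (hθ : 0 < θ)
    (h : c * t ^ θ ≤ s) : t ^ (3 : ℕ) ≤ (s / c) ^ (3 / θ) := by
  have h1 : t ^ θ ≤ s / c := by
    rw [le_div_iff₀ hc, mul_comm]
    exact h
  have h2 : (t ^ θ) ^ (3 / θ) ≤ (s / c) ^ (3 / θ) :=
    Real.rpow_le_rpow (Real.rpow_nonneg ht θ) h1 (by positivity)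
  have h3 : (t ^ θ) ^ (3 / θ) = t ^ (3 : ℕ) := by
    rw [← Real.rpow_mul ht, show θ * (3 / θ) = (3 : ℝ) by field_simp,
      show (3 : ℝ) = ((3 : ℕ) : ℝ) by norm_num, Real.rpow_natCast]
  rwa [h3] at h2

/-- Weak Hall over the positive naturals gives a two-sided Hall bound over `ℤ` with an exponent
`θ ≤ 3` (shrink `θ` to `min θ 3`, then `hallBound_int_of_hallBound`). -/
theorem hall_int_of_weakHall (hH : WeakHall) :
    ∃ θ c : ℝ, 0 < θ ∧ θ ≤ 3 ∧ 0 < c ∧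
      ∀ x y : ℤ, x ^ 3 ≠ y ^ 2 → c * |(x : ℝ)| ^ θ ≤ |(x : ℝ) ^ 3 - (y : ℝ) ^ 2| := by
  obtain ⟨θ, C, hθ, hC, h⟩ := hH
  refine ⟨min θ 3, min C 1, lt_min hθ (by norm_num), min_le_right _ _, lt_min hC one_pos, ?_⟩
  have h' : HallBound (min θ 3) C := by
    intro x y hx hy hne
    have hx1 : (1 : ℝ) ≤ (x : ℝ) := by exact_mod_cast hx
    calc C * (x : ℝ) ^ (min θ 3) ≤ C * (x : ℝ) ^ θ :=
          mul_le_mul_of_nonneg_left (Real.rpow_le_rpow_of_exponent_le hx1 (min_le_left _ _)) hC.le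
      _ ≤ |(x : ℝ) ^ 3 - (y : ℝ) ^ 2| := h x y hx hy hne
  exact hallBound_int_of_hallBound (min_le_right θ 3) h'

/-- The real-analysis core: from `D ≤ C₁ N^{K₁}` (Szpiro half) and `c · c4 ^ θ ≤ 1728 D` (Hall half,
at `(c₄, c₆)` via `c₄³ − c₆² = 1728 Δ`) to `max D (c4³) ≤ C · N ^ K` with explicit `C, K`. -/
theorem max_bound_aux {N D c4 C₁ K₁ c θ : ℝ} (hN : 1 ≤ N) (hC₁ : 1 ≤ C₁) (hK₁ : 0 ≤ K₁)
    (hc : 0 < c) (hθ : 0 < θ) (hΔ : D ≤ C₁ * N ^ K₁) (hc4 : 0 ≤ c4)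
    (hHall : c * c4 ^ θ ≤ 1728 * D) :
    max D (c4 ^ 3) ≤ (C₁ + (1728 * C₁ / c) ^ (3 / θ)) * N ^ (K₁ + K₁ * (3 / θ) + 3) := by
  have hN0 : 0 < N := by linarith
  have hK3 : 0 ≤ K₁ * (3 / θ) := mul_nonneg hK₁ (div_nonneg (by norm_num) hθ.le)
  have hB0 : 0 ≤ 1728 * C₁ / c := div_nonneg (mul_nonneg (by norm_num) (by linarith)) hc.le
  have hA0 : 0 ≤ (1728 * C₁ / c) ^ (3 / θ) := Real.rpow_nonneg hB0 _
  have hs : c * c4 ^ θ ≤ 1728 * C₁ * N ^ K₁ := by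
    calc c * c4 ^ θ ≤ 1728 * D := hHall
      _ ≤ 1728 * (C₁ * N ^ K₁) := mul_le_mul_of_nonneg_left hΔ (by norm_num)
      _ = 1728 * C₁ * N ^ K₁ := by ring
  have h3 : c4 ^ (3 : ℕ) ≤ (1728 * C₁ * N ^ K₁ / c) ^ (3 / θ) := pow_three_le_of_hall hc4 hc hθ hs
  have hsplit : (1728 * C₁ * N ^ K₁ / c) ^ (3 / θ) =
      (1728 * C₁ / c) ^ (3 / θ) * N ^ (K₁ * (3 / θ)) := by
    rw [show 1728 * C₁ * N ^ K₁ / c = (1728 * C₁ / c) * N ^ K₁ by ring,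
      Real.mul_rpow hB0 (Real.rpow_nonneg hN0.le _), ← Real.rpow_mul hN0.le]
  refine max_le ?_ ?_
  · calc D ≤ C₁ * N ^ K₁ := hΔ
      _ ≤ (C₁ + (1728 * C₁ / c) ^ (3 / θ)) * N ^ (K₁ + K₁ * (3 / θ) + 3) :=
          mul_le_mul (by linarith) (Real.rpow_le_rpow_of_exponent_le hN (by linarith))
            (Real.rpow_nonneg hN0.le _) (by linarith)
  · calc c4 ^ 3 ≤ (1728 * C₁ * N ^ K₁ / c) ^ (3 / θ) := h3
      _ = (1728 * C₁ / c) ^ (3 / θ) * N ^ (K₁ * (3 / θ)) := hsplit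
      _ ≤ (C₁ + (1728 * C₁ / c) ^ (3 / θ)) * N ^ (K₁ + K₁ * (3 / θ) + 3) :=
          mul_le_mul (by linarith) (Real.rpow_le_rpow_of_exponent_le hN (by linarith))
            (Real.rpow_nonneg hN0.le _) (by linarith)

/-- FACTORISATION `N ↦ Δ ↦ c₄`: weak Szpiro and weak Hall give WEAK GENERALIZED SZPIRO — a
polynomial bound for `M⁺ = max(|Δ|, |c₄|³)` of every global minimal model (`K ≥ 3`, `C ≥ 1`
normalised for the box argument).  Ingredients: `minimalDiscriminantNorm_eq_natAbs_holds`
(`N(𝔇_min) = |Δ(W₀)|` for a global minimal `W₀`), `c_relation` (`1728 Δ = c₄³ − c₆²`). -/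
theorem weakGenSzpiro_of_weakSzpiro_of_weakHall (hS : WeakSzpiro) (hH : WeakHall) :
    ∃ K C : ℝ, 3 ≤ K ∧ 1 ≤ C ∧ ∀ W₀ : WeierstrassCurve ℤ, (W₀.baseChange ℚ).IsElliptic →
      (∀ v : HeightOneSpectrum ℤ, (W₀.baseChange ℚ).IsMinimalAt v) →
        ((max |W₀.Δ| (|W₀.c₄| ^ 3) : ℤ) : ℝ) ≤
          C * (((W₀.baseChange ℚ).conductorNorm ℤ : ℕ) : ℝ) ^ K := by
  obtain ⟨K₁, C₁, hS⟩ := hS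
  obtain ⟨θ, c, hθ, -, hc, hHZ⟩ := hall_int_of_weakHall hH
  have hK : (0 : ℝ) ≤ max K₁ 0 := le_max_right _ _
  have hC : (1 : ℝ) ≤ max C₁ 1 := le_max_right _ _
  have hK3 : 0 ≤ max K₁ 0 * (3 / θ) := mul_nonneg hK (div_nonneg (by norm_num) hθ.le)
  have hA0 : 0 ≤ (1728 * max C₁ 1 / c) ^ (3 / θ) :=
    Real.rpow_nonneg (div_nonneg (mul_nonneg (by norm_num) (by linarith)) hc.le) _
  refine ⟨max K₁ 0 + max K₁ 0 * (3 / θ) + 3, max C₁ 1 + (1728 * max C₁ 1 / c) ^ (3 / θ),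
    by linarith, by linarith, ?_⟩
  intro W₀ hE hmin
  have hN1 : (1 : ℝ) ≤ (((W₀.baseChange ℚ).conductorNorm ℤ : ℕ) : ℝ) := by
    exact_mod_cast conductorNorm_pos_holds (W₀.baseChange ℚ)
  have hΔ0 : W₀.Δ ≠ 0 := Δ_ne_zero_of_isElliptic_baseChange_int W₀
  -- Szpiro half, normalised: |Δ| ≤ C₁' N^{K₁'}
  have hΔ : |(W₀.Δ : ℝ)| ≤ max C₁ 1 * (((W₀.baseChange ℚ).conductorNorm ℤ : ℕ) : ℝ) ^ (max K₁ 0) := by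
    have h1 := hS (W₀.baseChange ℚ)
    rw [minimalDiscriminantNorm_eq_natAbs_holds W₀ hΔ0 hmin, Nat.cast_natAbs, Int.cast_abs] at h1
    calc |(W₀.Δ : ℝ)| ≤ C₁ * (((W₀.baseChange ℚ).conductorNorm ℤ : ℕ) : ℝ) ^ K₁ := h1
      _ ≤ max C₁ 1 * (((W₀.baseChange ℚ).conductorNorm ℤ : ℕ) : ℝ) ^ K₁ :=
          mul_le_mul_of_nonneg_right (le_max_left _ _) (Real.rpow_nonneg (by linarith) _)
      _ ≤ max C₁ 1 * (((W₀.baseChange ℚ).conductorNorm ℤ : ℕ) : ℝ) ^ (max K₁ 0) :=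
          mul_le_mul_of_nonneg_left (Real.rpow_le_rpow_of_exponent_le hN1 (le_max_left _ _))
            (by linarith)
  -- Hall half at (c₄, c₆): c |c₄|^θ ≤ |c₄³ − c₆²| = 1728 |Δ|
  have hne : W₀.c₄ ^ 3 ≠ W₀.c₆ ^ 2 := by
    intro h
    apply hΔ0
    have hrel := W₀.c_relation
    rw [h, sub_self] at hrel
    exact (mul_eq_zero.mp hrel).resolve_left (by norm_num)
  have hHall : c * |(W₀.c₄ : ℝ)| ^ θ ≤ 1728 * |(W₀.Δ : ℝ)| := by
    have hrelR : (W₀.c₄ : ℝ) ^ 3 - (W₀.c₆ : ℝ) ^ 2 = 1728 * (W₀.Δ : ℝ) := by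
      exact_mod_cast W₀.c_relation.symm
    calc c * |(W₀.c₄ : ℝ)| ^ θ ≤ |(W₀.c₄ : ℝ) ^ 3 - (W₀.c₆ : ℝ) ^ 2| := hHZ W₀.c₄ W₀.c₆ hne
      _ = 1728 * |(W₀.Δ : ℝ)| := by
          rw [hrelR, abs_mul, abs_of_pos (by norm_num : (0 : ℝ) < 1728)]
  have key := max_bound_aux hN1 hC hK hc hθ hΔ (abs_nonneg (W₀.c₄ : ℝ)) hHall
  push_cast
  exact key

/-- The card's `InertBox` (elementary; no Shafarevich finiteness, no twist facts): weak generalized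
Szpiro with exponent `K ≥ 3` and constant `C ≥ 1` ⟹ the crux, with the witness window
`κ := K + 1`, `σ := K + 2`, `δ := 0 < 1/(2K − 2) = (σ − κ)/(2σ − 6)`.  A window curve has
`N^{K+1} ≤ M⁺ ≤ C N^K`, so `N ≤ C`: every window slice sits inside the FIXED finite slice at scale
`C` (`windowSet_finite`, landed cdisprove support), whose cardinality is the constant. -/
theorem someWindowSaving_of_weakGenSzpiro
    (h : ∃ K C : ℝ, 3 ≤ K ∧ 1 ≤ C ∧ ∀ W₀ : WeierstrassCurve ℤ, (W₀.baseChange ℚ).IsElliptic →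
      (∀ v : HeightOneSpectrum ℤ, (W₀.baseChange ℚ).IsMinimalAt v) →
        ((max |W₀.Δ| (|W₀.c₄| ^ 3) : ℤ) : ℝ) ≤
          C * (((W₀.baseChange ℚ).conductorNorm ℤ : ℕ) : ℝ) ^ K) :
    ∃ κ σ δ C : ℝ, 3 < κ ∧ κ < σ ∧ δ < (σ - κ) / (2 * σ - 6) ∧
      ∀ X : ℝ, 1 ≤ X → (windowCount κ σ X : ℝ) ≤ C * X ^ δ := by
  obtain ⟨K, C, hK, hC, h⟩ := h
  refine ⟨K + 1, K + 2, 0, ((windowSet (K + 1) (K + 2) C).ncard : ℝ), by linarith, by linarith,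
    ?_, ?_⟩
  · rw [show (K + 2 - (K + 1)) / (2 * (K + 2) - 6) = 1 / (2 * K - 2) by ring]
    exact div_pos one_pos (by linarith)
  · intro X hX
    rw [Real.rpow_zero, mul_one]
    have hsub : windowSet (K + 1) (K + 2) X ⊆ windowSet (K + 1) (K + 2) C := by
      intro W hW
      obtain ⟨hE, hmin, ha₁, ha₃, ha₂, hc₄, hc₆, hNX, hlow, hup⟩ := hW
      refine ⟨hE, hmin, ha₁, ha₃, ha₂, hc₄, hc₆, ?_, hlow, hup⟩
      have hN1 : (1 : ℝ) ≤ (((W.baseChange ℚ).conductorNorm ℤ : ℕ) : ℝ) := by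
        exact_mod_cast conductorNorm_pos_holds (W.baseChange ℚ)
      have hN0 : (0 : ℝ) < (((W.baseChange ℚ).conductorNorm ℤ : ℕ) : ℝ) := by linarith
      have h1 : (((W.baseChange ℚ).conductorNorm ℤ : ℕ) : ℝ) ^ (K + 1) ≤
          C * (((W.baseChange ℚ).conductorNorm ℤ : ℕ) : ℝ) ^ K := hlow.trans (h W hE hmin)
      have h2 : (((W.baseChange ℚ).conductorNorm ℤ : ℕ) : ℝ) *
          (((W.baseChange ℚ).conductorNorm ℤ : ℕ) : ℝ) ^ K ≤
          C * (((W.baseChange ℚ).conductorNorm ℤ : ℕ) : ℝ) ^ K := by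
        calc (((W.baseChange ℚ).conductorNorm ℤ : ℕ) : ℝ) *
              (((W.baseChange ℚ).conductorNorm ℤ : ℕ) : ℝ) ^ K
            = (((W.baseChange ℚ).conductorNorm ℤ : ℕ) : ℝ) ^ (K + 1) := by
              rw [Real.rpow_add hN0, Real.rpow_one, mul_comm]
          _ ≤ C * (((W.baseChange ℚ).conductorNorm ℤ : ℕ) : ℝ) ^ K := h1
      exact le_of_mul_le_mul_right h2 (Real.rpow_pos_of_pos hN0 K)
    exact_mod_cast Set.ncard_le_ncard hsub (windowSet_finite _ _ _)

/-! ## The composition: the two stubs imply the crux, BY NAME (kernel-checked; no `sorry` below) -/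

/-- **`SomeWindowSaving_of`** — the glue of the line: weak Szpiro (`N ↦ Δ`) and weak Hall (`Δ ↦ c₄`) give
weak generalized Szpiro (`weakGenSzpiro_of_weakSzpiro_of_weakHall`), and the box is inert
(`someWindowSaving_of_weakGenSzpiro` + the definitional `someWindowSaving_iff` of `Negative.Defs`). -/
theorem SomeWindowSaving_of (h1 : Registered.stub_weakSzpiro) (h2 : Registered.stub_weakHall) :
    Summit.ABC.ABC.Theses.TwistAmplification.SomeWindowSaving :=
  someWindowSaving_iff.mpr (someWindowSaving_of_weakGenSzpiro (weakGenSzpiro_of_weakSzpiro_of_weakHall h1 h2))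

/-- Wiring check: the registered stubs feed `SomeWindowSaving_of` as stated (the verbatim restatements are
definitionally the named statements). -/
example : Summit.ABC.ABC.Theses.TwistAmplification.SomeWindowSaving :=
  SomeWindowSaving_of stub_weakSzpiro stub_weakHall

/-! ## Consistency relative to the summit (gen-2 addition; kernel-checked, no `sorry`)

Both stubs are weakenings of catalogued conjectures of the Literature, typed in the same vocabulary, and both
follow from the summit statement `_root_.ABC` (`:= Literature.Abc.ABCConjecture`) through theorems of the tree.
Hence `ABC ⟹ stub_weakSzpiro ∧ stub_weakHall ⟹ SomeWindowSaving`: (a) neither stub (nor the crux) is refutable by an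
unconditional Negative lemma unless abc is false — the formal content of the disprover's verdict "resists";
(b) the stub signatures are pinned against the audited conjecture texts.  NOT claimed (and, as far as this seat
knows, not known): that WEAK abc (`∃ K', c ≤ C·rad(abc)^{K'}`) returns either stub — the passages abc ⟹ Szpiro
(`(c₄³/G, −c₆²/G, 1728Δ/G)`) and abc ⟹ Hall (`(x³/g, −y²/g, k/g)`) both lose the factor `|c₄c₆| ≤ M^{5/6}`
(resp. `xy ≤ x^{5/2}`) in the radical and need the abc exponent below `6/5`. -/

open Literature.NumberTheory.EllipticCurves (SzpiroConjecture szpiro_of_abcLe_holds)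
open Literature.NumberTheory.DiophantineGeometry (HallConjecture hallConjecture_of_abc)

/-- `SzpiroConjecture` (abc.S09, Silverman AEC VIII.11.1: `∀ ε > 0 ∃ C, |Δ_min| ≤ C · N^{6+ε}` for all `E/ℚ`)
⟹ STUB 1, with `K := 6 + 1`. -/
theorem weakSzpiro_of_szpiroConjecture (h : SzpiroConjecture) : WeakSzpiro := by
  obtain ⟨C, hC⟩ := h 1 one_pos
  exact ⟨6 + 1, C, hC⟩

/-- `HallConjecture` (abc.S17: `∀ ε > 0 ∃ C > 0, C · x^{1/2−ε} ≤ |x³ − y²|`, i.e. `HallBound (1/2 − ε) C`,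
`hallConjecture_iff`) ⟹ STUB 2, with `θ := 1/2 − 1/4`. -/
theorem weakHall_of_hallConjecture (h : HallConjecture) : WeakHall := by
  obtain ⟨C, hC, hH⟩ := h (1 / 4) (by norm_num)
  exact ⟨1 / 2 - 1 / 4, C, by norm_num, hC, hH⟩

/-- The summit implies both stubs.  `_root_.ABC` is definitionally `Literature.Abc.ABCConjecture`, whose body is
verbatim the hypothesis of `hallConjecture_of_abc` (PROVED; Bombieri–Gubler Thm. 12.5.12) and — weakened from
`<` / `0 < C` to `≤` — that of `szpiro_of_abcLe_holds` (PROVED; Silverman Prop. VIII.11.5(b): abc ⟹ Szpiro for ALL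
`E/ℚ` through `gcd(c₄³, c₆²)`-control at additive primes). -/
theorem stubs_of_abc (habc : _root_.ABC) : WeakSzpiro ∧ WeakHall := by
  refine ⟨weakSzpiro_of_szpiroConjecture (szpiro_of_abcLe_holds fun ε hε => ?_),
    weakHall_of_hallConjecture (hallConjecture_of_abc habc)⟩
  obtain ⟨C, -, hC⟩ := habc ε hε
  exact ⟨C, fun a b c h => (hC a b c h).le⟩

/-- Hence summit ⟹ crux along this line — deliberately an unnamed `example` (see the module docstring). -/
example (habc : _root_.ABC) : Summit.ABC.ABC.Theses.TwistAmplification.SomeWindowSaving :=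
  SomeWindowSaving_of (stubs_of_abc habc).1 (stubs_of_abc habc).2

end Summit.ABC.ABC.Cruxes.SomeWindowSaving.InertBoxCollapse

end
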